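import Summits.BirchSwinnertonDyer.BirchSwinnertonDyer.Theorems.ManinLocalTwoThreePinningTwoFiftyTwoTablesC
import HarnessLib

/-!
# Level 252 by the PINNING KERNEL — table certificates (part 4 of 18)

Cell `bsd-f2-manin`, route `ManinLocalTwoThree`, crux C2 `ManinOddAtFour` (stmt-BirchSwinnertonDyer-22967) AND C3 `ManinPrimeToThreeAtNine`
(stmt-BirchSwinnertonDyer-22968; `4 ∣ 252` and `9 ∣ 252`: the level lies in BOTH crux domains), an g57 (pipeline of an g56);
`--supports stmt-BirchSwinnertonDyer-22967` (helper).  The convolution certificates `tabsᵢ · DEN(rᵢ) = NUM(rᵢ, aᵢ)` (depth 192,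
SPARSE certificates of an g55 `…EtaCertificateSparse` (trivial products skipped, pentagonal Euler tables of p3 `…EtaCertificateFast`), one `decide +kernel` each) of forms `14 … 17` of `…PinningTwoFiftyTwoTables`.
HONEST FRAMING: kernel-checked identities of integer lists only. [cite: Koehler2011, §2.1]
-/

set_option autoImplicit false
-- lint-debt: the directory name repeats the summit name (sibling precedent `ManinLocalTwoThreePinningSixtyThree.lean`)
set_option linter.dupNamespace false

noncomputable section


open Complex
open UpperHalfPlane hiding I
open scoped MatrixGroups ModularForm
open ModularForm CongruenceSubgroup
open Literature.NumberTheory.ModularForms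
open Literature.NumberTheory.EllipticCurves Literature.NumberTheory.EllipticCurves.ModularForms

namespace Summit.BirchSwinnertonDyer.BirchSwinnertonDyer.Theorems.ManinLocalTwoThree.PinningTwoFiftyTwo

open Summit.BirchSwinnertonDyer.BirchSwinnertonDyer.Theorems.ManinLocalTwoThree.BracketSturm
open Summit.BirchSwinnertonDyer.BirchSwinnertonDyer.Theorems.ManinLocalTwoThree.PinningKernel


set_option maxHeartbeats 4000000
set_option maxRecDepth 16384

/-! ## §2d Table certificates (forms `14 … 17`) -/

/-- Table certificate of the basis quotient `14` (kernel `decide`). [folklore] -/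
theorem hcert14 : mulList 192 (tabs 14) (etaDenListSparse 192 252 (expFn (Ls[14]).1)) = etaNumListSparse 192 252 (expFn (Ls[14]).1) (shifts 14) := by decide +kernel
/-- Table certificate of the basis quotient `15` (kernel `decide`). [folklore] -/
theorem hcert15 : mulList 192 (tabs 15) (etaDenListSparse 192 252 (expFn (Ls[15]).1)) = etaNumListSparse 192 252 (expFn (Ls[15]).1) (shifts 15) := by decide +kernel
/-- Table certificate of the basis quotient `16` (kernel `decide`). [folklore] -/
theorem hcert16 : mulList 192 (tabs 16) (etaDenListSparse 192 252 (expFn (Ls[16]).1)) = etaNumListSparse 192 252 (expFn (Ls[16]).1) (shifts 16) := by decide +kernel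
/-- Table certificate of the basis quotient `17` (kernel `decide`). [folklore] -/
theorem hcert17 : mulList 192 (tabs 17) (etaDenListSparse 192 252 (expFn (Ls[17]).1)) = etaNumListSparse 192 252 (expFn (Ls[17]).1) (shifts 17) := by decide +kernel

end Summit.BirchSwinnertonDyer.BirchSwinnertonDyer.Theorems.ManinLocalTwoThree.PinningTwoFiftyTwo

end
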